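import Mathlib
import Summits.Ventures.PercRepro2.ZMeanProof
import Summits.Ventures.PercRepro2.PendantRoot
import Summits.Ventures.PercRepro2.A3LeafQuadratic
import Summits.Ventures.PercRepro2.HMFLeaf

/-!
# The mean field is quadratic along a leaf edge at `a₃` (blind cell PercRepro2, night-1 g6;
NIGHT1-G6.md §12 — the (HMF) leaf step)

Let `a₃` be a LEAF with its only edge `f = {a₃, y}` (`y` arbitrary: a root, `o`, `b` or an unmarked
vertex).  Along the weight `t = p f` every mass of `HMFc` is affine (`A3Leaf.prob_update_mix`) and so is
the mean-field sum `X̂` (`Xhat_update_mix`): a row of `X̂` is indexed by a cluster `W ∋ a₃`, and its term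
`termW(W)` is computed in `G ∖ W`, which has no edge `f` — so the term is free of `f`
(`termW_update_of_mem`); the rows with `a₃ ∉ W` are empty.  Hence (`HMFc_leaf_eq`)

  `HMFc(p[f ↦ t]) = (1 − t) HMFc(p[f ↦ 0]) + t HMFc(p[f ↦ 1]) − t(1 − t) · 2[HMFc(0) + HMFc(1) − 2 HMFc(½)]`,

the mean-field analogue of `A3Leaf.Gc_leaf_eq`.  With `HMFc(p[f ↦ 0]) = 0` (the mean field is exact at
an isolated `a₃`; kernel-checked at the four marked attachment points) this is the **(HMF) leaf step**:
`HMFc(p) = t·HMFc(G/f) + t(1 − t)·κ`, so (HMF) at the leaf follows from (HMF) at the contracted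
instance and the first-order attachment inequality `κ ≥ 0` ((ATT-y): theorems for `y` a root, `o`, `b`;
census-true 548 / 548 for `y` unmarked).
-/

namespace Summit.Ventures.PercRepro2

open UnionCluster CovForm PendantRoot HMFPendantRoot

namespace HMFLeafStep

variable {V : Type*} {E : Type*} [Fintype E] [DecidableEq E] [Fintype V] [DecidableEq V]
  {R : Type*} [Field R] [LinearOrder R] [IsStrictOrderedRing R]

variable (p : E → R) (ends : E → Sym2 V) {f : E} {a₃ y : V}

omit [LinearOrder R] [IsStrictOrderedRing R] in
/-- A row of `X̂` indexed by a cluster containing `a₃` does not depend on the weight of an edge at `a₃`: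
its residual masses live in `G ∖ W`. -/
lemma termW_update_of_mem (hf : ends f = s(a₃, y)) {W : Finset V} (h3W : a₃ ∈ W) (o a₁ a₂ b : V)
    (t : R) : termW (Function.update p f t) ends o a₁ a₂ b W = termW p ends o a₁ a₂ b W := by
  have hfW : f ∈ touches ends (↑W : Set V) := mem_touches_of_ends hf (Or.inl (Finset.mem_coe.2 h3W))
  have hc : ∀ x v : V, prob (Function.update p f t) (connDelEvent ends W x v) =
      prob p (connDelEvent ends W x v) := fun x v =>
    PendantEdm.prob_update_of_free p
      (free_of_dependsOn_touches_compl ends hfW (dependsOn_connDelEvent ends W x v)) t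
  have hQ : prob (Function.update p f t) (delQ ends W a₁ a₂) = prob p (delQ ends W a₁ a₂) :=
    PendantEdm.prob_update_of_free p
      (free_of_dependsOn_touches_compl ends hfW (dependsOn_connDelEvent ends W a₁ a₂)).compl t
  have hQc : ∀ x v : V, prob (Function.update p f t) (delQ ends W a₁ a₂ ∩ connDelEvent ends W x v) =
      prob p (delQ ends W a₁ a₂ ∩ connDelEvent ends W x v) := fun x v =>
    PendantEdm.prob_update_of_free p
      ((free_of_dependsOn_touches_compl ends hfW (dependsOn_connDelEvent ends W a₁ a₂)).compl.inter
        (free_of_dependsOn_touches_compl ends hfW (dependsOn_connDelEvent ends W x v))) t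
  simp only [termW, termT, termPD, delConnProb, delShareMass, hc, hQ, hQc]

omit [LinearOrder R] [IsStrictOrderedRing R] in
/-- **`X̂` is affine along the weight of a leaf edge at `a₃`.** -/
lemma Xhat_update_mix (hf : ends f = s(a₃, y)) (o a₁ a₂ b : V) (t : R) :
    Xhat (Function.update p f t) ends o a₁ a₂ a₃ b =
      (1 - t) * Xhat (Function.update p f 0) ends o a₁ a₂ a₃ b +
        t * Xhat (Function.update p f 1) ends o a₁ a₂ a₃ b := by
  simp only [Xhat_eq_sum, Finset.mul_sum, ← Finset.sum_add_distrib]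
  refine Finset.sum_congr rfl fun W _ => ?_
  by_cases h3 : a₃ ∈ W
  · rw [termW_update_of_mem p ends hf h3 o a₁ a₂ b t, termW_update_of_mem p ends hf h3 o a₁ a₂ b 0,
      termW_update_of_mem p ends hf h3 o a₁ a₂ b 1, A3Leaf.prob_update_mix p f _ t]
    ring
  · have hW : clusterEvent ends a₃ (↑W : Set V) = ∅ := by
      ext ω
      simp only [mem_clusterEvent, Set.mem_empty_iff_false, iff_false]
      intro h
      apply h3
      have : a₃ ∈ cluster ends ω a₃ := conn_refl ends ω a₃
      rw [h] at this
      exact Finset.mem_coe.1 this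
    simp [hW, prob_empty]

/-- **The mean field is quadratic along a leaf edge at `a₃`** (the analogue of `A3Leaf.Gc_leaf_eq`):
`HMFc(p[f ↦ t]) = (1 − t) HMFc(0) + t HMFc(1) − t(1 − t) · 2[HMFc(0) + HMFc(1) − 2 HMFc(½)]`. -/
theorem HMFc_leaf_eq (hf : ends f = s(a₃, y)) (hleaf : ∀ e, a₃ ∈ ends e → e = f) (h3y : a₃ ≠ y)
    {o a₁ a₂ b : V} (h31 : a₃ ≠ a₁) (h32 : a₃ ≠ a₂) (h3o : a₃ ≠ o) (h3b : a₃ ≠ b) (t : R) :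
    HMFc (Function.update p f t) ends o a₁ a₂ a₃ b =
      (1 - t) * HMFc (Function.update p f 0) ends o a₁ a₂ a₃ b +
        t * HMFc (Function.update p f 1) ends o a₁ a₂ a₃ b -
        t * (1 - t) * (2 * (HMFc (Function.update p f 0) ends o a₁ a₂ a₃ b +
          HMFc (Function.update p f 1) ends o a₁ a₂ a₃ b -
          2 * HMFc (Function.update p f (1 / 2)) ends o a₁ a₂ a₃ b)) := by
  have fc : ∀ {x z : V}, x ≠ a₃ → z ≠ a₃ → Free f (connEvent ends x z) :=
    fun hx hz => free_connEvent hf hleaf h3y hx hz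
  have fQ : Free f (avoidAll ends a₂ {a₁}) := by
    rw [avoidAll_eq_compl]
    exact (fc (Ne.symm h31) (Ne.symm h32)).compl
  -- constant blocks
  have hPQ : ∀ s : R, prob (Function.update p f s) (avoidAll ends a₂ {a₁}) =
      prob p (avoidAll ends a₂ {a₁}) := fun s => PendantEdm.prob_update_of_free p fQ s
  have hEQo : ∀ s : R, EQo (Function.update p f s) ends o a₁ a₂ = EQo p ends o a₁ a₂ := by
    intro s
    simp only [EQo]
    rw [PendantEdm.prob_update_of_free p (fQ.inter (fc (Ne.symm h31) (Ne.symm h3o))) s,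
      PendantEdm.prob_update_of_free p (fQ.inter (fc (Ne.symm h32) (Ne.symm h3o))) s]
  have hgap : ∀ s : R, gap (Function.update p f s) ends a₁ a₂ b = gap p ends a₁ a₂ b := by
    intro s
    simp only [gap]
    rw [PendantEdm.prob_update_of_free p (fc (Ne.symm h32) (Ne.symm h3b)) s,
      PendantEdm.prob_update_of_free p (fc (Ne.symm h31) (Ne.symm h3b)) s]
  -- affine blocks
  have hm : ∀ (A : Set (Config E)) (s : R), prob (Function.update p f s) A =
      (1 - s) * prob (Function.update p f 0) A + s * prob (Function.update p f 1) A :=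
    fun A s => A3Leaf.prob_update_mix p f A s
  have hX : ∀ s : R, Xhat (Function.update p f s) ends o a₁ a₂ a₃ b =
      (1 - s) * Xhat (Function.update p f 0) ends o a₁ a₂ a₃ b +
        s * Xhat (Function.update p f 1) ends o a₁ a₂ a₃ b :=
    fun s => Xhat_update_mix p ends hf o a₁ a₂ b s
  simp only [HMFc, marginC, DEF, Do, EQ3, EQ3o, massM2, deltaT]
  simp only [hPQ, hEQo, hgap]
  rw [hX t, hX (1 / 2)]
  simp only [hm _ t, hm _ (1 / 2)]
  ring

end HMFLeafStep

end Summit.Ventures.PercRepro2
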